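import Summits.HubbardSuperconductivity.HubbardSuperconductivity.Theorems.AnisotropyChordTransferFibre3TargetsV2
import Summits.HubbardSuperconductivity.HubbardSuperconductivity.Theorems.AnisotropyChordTransferFibre3MinAttained

/-!
# Route `AnisotropyChord` / H0 rotor rung: PORT N30-A — hopping-form lower bound for the free fibre Hamiltonian

Towards `ShellDirichletBound` ((MI) ingredient §284(b)(ii), memo ROTOR-THEORY-20, theory seat `hubbard-h0-rotor-theory-1`,
cycle 20): for `Y` vanishing on the hard core `D`,
  `Re⟨Y, H₀Y⟩ ≥ ½ Σ_c cnt(c)·‖Y c‖²`,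
where `cnt(c)` counts, among the twelve hops out of `c` (`(a±e,b)`, `(a,b±e)`, `(a∓e,b∓e)`, `e = eₓ, e_y`), those landing
in `D` (`re_ip_H0apply_ge_cnt`).  Proof: `⟨Y,H₀Y⟩ = 6‖Y‖² − ½·(hopping sum)` (`ip_H0apply`), each directed hop term is
`≤ ½‖Y c‖²(1 − [c' ∈ D]) + ½‖Y c'‖²(1 − [c ∈ D])`, and the second half is re-indexed by the translation.
The combinatorial step `cnt(c) ≥ 2W(c)` off `D` and `ShellDirichletBound` itself are in `…TransferFibre3Shell`.
Prover seat `hubbard-h0-rotor-p1` g21; helper for stmt-HubbardSuperconductivity-19089 (`--supports`).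
-/

set_option linter.dupNamespace false
set_option autoImplicit false

noncomputable section

open scoped BigOperators
open Complex

namespace Summit.HubbardSuperconductivity.HubbardSuperconductivity.Theorems.AnisotropyChord.Transfer.Fibre3

variable (L : ℕ) [NeZero L]

/-- indicator of the hard core, as a real number. [folklore] -/
def Dind (c : Cfg L) : ℝ := if InD L c = true then 1 else 0

omit [NeZero L] in
/-- [folklore] -/
theorem Dind_nonneg (c : Cfg L) : 0 ≤ Dind L c := by unfold Dind; split_ifs <;> norm_num

omit [NeZero L] in
/-- [folklore] -/
theorem Dind_le_one (c : Cfg L) : Dind L c ≤ 1 := by unfold Dind; split_ifs <;> norm_num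

/-- `‖phase K r‖ = 1`. [folklore] -/
theorem norm_phase (K r : Tor L) : ‖phase L K r‖ = 1 := by
  have h : phase L K r * (starRingEnd ℂ) (phase L K r) = 1 := by rw [conj_phase, phase_mul_neg]
  have h2 : Complex.normSq (phase L K r) = 1 := by
    have := Complex.mul_conj (phase L K r); rw [h] at this; exact_mod_cast this.symm
  rw [Complex.normSq_eq_norm_sq] at h2
  nlinarith [norm_nonneg (phase L K r)]

/-- **one directed hop:** for `Y` vanishing on `D`, a translation `w` and a unit phase `φ`,
`Re Σ_c conj(Y c)·φ·Y(c + w) ≤ ½ Σ_c ‖Y c‖²(1 − [c+w ∈ D]) + ½ Σ_c ‖Y c‖²(1 − [c−w ∈ D])`. [folklore] -/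
theorem re_hop_le (Y : Cfg L → ℂ) (hY : ∀ c, InD L c = true → Y c = 0) (w : Cfg L) (φ : ℂ) (hφ : ‖φ‖ = 1) :
    (∑ c : Cfg L, (starRingEnd ℂ) (Y c) * (φ * Y (c + w))).re
      ≤ (1 / 2) * ∑ c : Cfg L, ‖Y c‖ ^ 2 * (1 - Dind L (c + w))
        + (1 / 2) * ∑ c : Cfg L, ‖Y c‖ ^ 2 * (1 - Dind L (c - w)) := by
  rw [Complex.re_sum]
  -- termwise bound
  have hterm : ∀ c : Cfg L, ((starRingEnd ℂ) (Y c) * (φ * Y (c + w))).re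
      ≤ (1 / 2) * (‖Y c‖ ^ 2 * (1 - Dind L (c + w))) + (1 / 2) * (‖Y (c + w)‖ ^ 2 * (1 - Dind L c)) := by
    intro c
    by_cases h1 : InD L (c + w) = true
    · rw [hY _ h1]; simp only [mul_zero, Complex.zero_re, norm_zero]
      have := Dind_le_one L (c + w); nlinarith [sq_nonneg ‖Y c‖]
    · by_cases h2 : InD L c = true
      · rw [hY _ h2]; simp only [map_zero, zero_mul, Complex.zero_re, norm_zero]
        have := Dind_le_one L c; nlinarith [sq_nonneg ‖Y (c + w)‖]
      · have e1 : Dind L (c + w) = 0 := by unfold Dind; simp [h1]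
        have e2 : Dind L c = 0 := by unfold Dind; simp [h2]
        simp only [e1, e2, sub_zero, mul_one]
        have hre : ((starRingEnd ℂ) (Y c) * (φ * Y (c + w))).re ≤ ‖(starRingEnd ℂ) (Y c) * (φ * Y (c + w))‖ :=
          Complex.re_le_norm _
        rw [norm_mul, norm_mul, Complex.norm_conj, hφ, one_mul] at hre
        nlinarith [sq_nonneg (‖Y c‖ - ‖Y (c + w)‖)]
  refine le_trans (Finset.sum_le_sum fun c _ => hterm c) ?_
  rw [Finset.sum_add_distrib, ← Finset.mul_sum, ← Finset.mul_sum]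
  -- reindex the second sum by the translation `c ↦ c + w`
  have hre : ∑ c : Cfg L, ‖Y (c + w)‖ ^ 2 * (1 - Dind L c) = ∑ c : Cfg L, ‖Y c‖ ^ 2 * (1 - Dind L (c - w)) := by
    refine Fintype.sum_equiv (Equiv.addRight w) _ _ fun c => ?_
    simp only [Equiv.coe_addRight, add_sub_cancel_right]
  rw [hre]

/-- per-direction weight `wt e c = Σ over the three hop types of (1 − [c+w ∈ D]) + (1 − [c−w ∈ D])`. [folklore] -/
def wt (e : Tor L) (c : Cfg L) : ℝ :=
  ((1 - Dind L (c + (e, 0))) + (1 - Dind L (c - (e, 0))))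
    + ((1 - Dind L (c + (0, e))) + (1 - Dind L (c - (0, e))))
    + ((1 - Dind L (c + (-e, -e))) + (1 - Dind L (c - (-e, -e))))

/-- the real part of a directional hopping form, bounded by the three hop types. [folklore] -/
theorem re_hopSum_le (Y : Cfg L → ℂ) (hY : ∀ c, InD L c = true → Y c = 0) (e : Tor L) :
    (hopSum L (K1 L) Y Y e).re ≤ (1 / 2) * ∑ c : Cfg L, ‖Y c‖ ^ 2 * wt L e c := by
  unfold hopSum
  have p1 : ∀ c : Cfg L, (c.1 + e, c.2) = c + (e, 0) := fun c => by ext <;> simp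
  have p2 : ∀ c : Cfg L, (c.1, c.2 + e) = c + (0, e) := fun c => by ext <;> simp
  have p3 : ∀ c : Cfg L, (c.1 - e, c.2 - e) = c + (-e, -e) := fun c => by ext <;> simp [sub_eq_add_neg]
  simp_rw [p1, p2, p3, mul_add, Finset.sum_add_distrib, Complex.add_re]
  have h1 := re_hop_le L Y hY ((e, 0) : Cfg L) 1 (by simp)
  have h2 := re_hop_le L Y hY ((0, e) : Cfg L) 1 (by simp)
  have h3 := re_hop_le L Y hY ((-e, -e) : Cfg L) (phase L (K1 L) e) (norm_phase L (K1 L) e)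
  simp only [one_mul] at h1 h2
  have hw : ∑ c : Cfg L, ‖Y c‖ ^ 2 * wt L e c
      = (∑ c : Cfg L, ‖Y c‖ ^ 2 * (1 - Dind L (c + (e, 0))) + ∑ c : Cfg L, ‖Y c‖ ^ 2 * (1 - Dind L (c - (e, 0))))
        + (∑ c : Cfg L, ‖Y c‖ ^ 2 * (1 - Dind L (c + (0, e))) + ∑ c : Cfg L, ‖Y c‖ ^ 2 * (1 - Dind L (c - (0, e))))
        + (∑ c : Cfg L, ‖Y c‖ ^ 2 * (1 - Dind L (c + (-e, -e)))
            + ∑ c : Cfg L, ‖Y c‖ ^ 2 * (1 - Dind L (c - (-e, -e)))) := by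
    unfold wt; simp only [mul_add, Finset.sum_add_distrib]
  rw [hw]; linarith

/-- the number of hops out of `c` landing in the hard core, as a real number:
`cnt(c) = Σ_{e = ±eₓ, ±e_y} ([c+(e,0) ∈ D] + [c+(0,e) ∈ D] + [c−(e,e) ∈ D])`. [folklore] -/
def cnt (c : Cfg L) : ℝ :=
  (Dind L (c + (ex L, 0)) + Dind L (c + (0, ex L)) + Dind L (c + (-ex L, -ex L)))
  + (Dind L (c + (-ex L, 0)) + Dind L (c + (0, -ex L)) + Dind L (c + (ex L, ex L)))
  + (Dind L (c + (ey L, 0)) + Dind L (c + (0, ey L)) + Dind L (c + (-ey L, -ey L)))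
  + (Dind L (c + (-ey L, 0)) + Dind L (c + (0, -ey L)) + Dind L (c + (ey L, ey L)))

omit [NeZero L] in
/-- pointwise bookkeeping: the four directional weights add up to `2(12 − cnt)`. [folklore] -/
theorem wt_sum_eq (c : Cfg L) : wt L (ex L) c + wt L (-ex L) c + wt L (ey L) c + wt L (-ey L) c = 2 * (12 - cnt L c) := by
  have s1 : c - ((ex L, 0) : Cfg L) = c + (-ex L, 0) := by ext <;> simp [sub_eq_add_neg]
  have s2 : c - ((0, ex L) : Cfg L) = c + (0, -ex L) := by ext <;> simp [sub_eq_add_neg]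
  have s3 : c - ((-ex L, -ex L) : Cfg L) = c + (ex L, ex L) := by ext <;> simp
  have s4 : c - ((-ex L, 0) : Cfg L) = c + (ex L, 0) := by ext <;> simp
  have s5 : c - ((0, -ex L) : Cfg L) = c + (0, ex L) := by ext <;> simp
  have s6 : c + ((- -ex L, - -ex L) : Cfg L) = c + (ex L, ex L) := by ext <;> simp
  have s7 : c - ((- -ex L, - -ex L) : Cfg L) = c + (-ex L, -ex L) := by ext <;> simp [sub_eq_add_neg]
  have t1 : c - ((ey L, 0) : Cfg L) = c + (-ey L, 0) := by ext <;> simp [sub_eq_add_neg]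
  have t2 : c - ((0, ey L) : Cfg L) = c + (0, -ey L) := by ext <;> simp [sub_eq_add_neg]
  have t3 : c - ((-ey L, -ey L) : Cfg L) = c + (ey L, ey L) := by ext <;> simp
  have t4 : c - ((-ey L, 0) : Cfg L) = c + (ey L, 0) := by ext <;> simp
  have t5 : c - ((0, -ey L) : Cfg L) = c + (0, ey L) := by ext <;> simp
  have t6 : c + ((- -ey L, - -ey L) : Cfg L) = c + (ey L, ey L) := by ext <;> simp
  have t7 : c - ((- -ey L, - -ey L) : Cfg L) = c + (-ey L, -ey L) := by ext <;> simp [sub_eq_add_neg]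
  unfold wt
  rw [s1, s2, s3, s4, s5, s6, s7, t1, t2, t3, t4, t5, t6, t7]
  unfold cnt
  ring

/-- **hopping-form lower bound:** `Re⟨Y, H₀Y⟩ ≥ ½ Σ_c cnt(c)‖Y c‖²` for `Y` vanishing on `D`. [folklore] -/
theorem re_ip_H0apply_ge_cnt (Y : Cfg L → ℂ) (hY : ∀ c, InD L c = true → Y c = 0) :
    (1 / 2) * ∑ c : Cfg L, cnt L c * ‖Y c‖ ^ 2 ≤ (ip L Y (H0apply L (K1 L) Y)).re := by
  rw [ip_H0apply]
  have hN : (ip L Y Y).re = ∑ c : Cfg L, ‖Y c‖ ^ 2 := ip_self_re L Y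
  have h1 := re_hopSum_le L Y hY (ex L)
  have h2 := re_hopSum_le L Y hY (-ex L)
  have h3 := re_hopSum_le L Y hY (ey L)
  have h4 := re_hopSum_le L Y hY (-ey L)
  have key : ∑ c : Cfg L, ‖Y c‖ ^ 2 * wt L (ex L) c + ∑ c : Cfg L, ‖Y c‖ ^ 2 * wt L (-ex L) c
      + ∑ c : Cfg L, ‖Y c‖ ^ 2 * wt L (ey L) c + ∑ c : Cfg L, ‖Y c‖ ^ 2 * wt L (-ey L) c
      = 24 * ∑ c : Cfg L, ‖Y c‖ ^ 2 - 2 * ∑ c : Cfg L, cnt L c * ‖Y c‖ ^ 2 := by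
    rw [← Finset.sum_add_distrib, ← Finset.sum_add_distrib, ← Finset.sum_add_distrib, Finset.mul_sum, Finset.mul_sum,
      ← Finset.sum_sub_distrib]
    refine Finset.sum_congr rfl fun c _ => ?_
    have := wt_sum_eq L c
    calc ‖Y c‖ ^ 2 * wt L (ex L) c + ‖Y c‖ ^ 2 * wt L (-ex L) c + ‖Y c‖ ^ 2 * wt L (ey L) c
          + ‖Y c‖ ^ 2 * wt L (-ey L) c
        = ‖Y c‖ ^ 2 * (wt L (ex L) c + wt L (-ex L) c + wt L (ey L) c + wt L (-ey L) c) := by ring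
      _ = 24 * ‖Y c‖ ^ 2 - 2 * (cnt L c * ‖Y c‖ ^ 2) := by rw [this]; ring
  have eH : (6 * ip L Y Y - (1 / 2 : ℂ) * (hopSum L (K1 L) Y Y (ex L) + hopSum L (K1 L) Y Y (-ex L)
      + hopSum L (K1 L) Y Y (ey L) + hopSum L (K1 L) Y Y (-ey L))).re
      = 6 * ∑ c : Cfg L, ‖Y c‖ ^ 2 - (1 / 2) * ((hopSum L (K1 L) Y Y (ex L)).re + (hopSum L (K1 L) Y Y (-ex L)).re
          + (hopSum L (K1 L) Y Y (ey L)).re + (hopSum L (K1 L) Y Y (-ey L)).re) := by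
    rw [← hN]; simp only [Complex.sub_re, Complex.mul_re, Complex.add_re]; norm_num
  rw [eH]
  linarith

end Summit.HubbardSuperconductivity.HubbardSuperconductivity.Theorems.AnisotropyChord.Transfer.Fibre3

end
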